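import Literature.Combinatorics.Designs.DifferenceSetMultiplier
import Mathlib.Data.ZMod.Basic
import Mathlib.Tactic.NormNum.Prime

/-!
# No cyclic projective plane of order 6: no planar `(43, 7, 1)` difference set in `ℤ/43` (kernel)
Framing: lottery ticket; floor = certified bounds/negative ranges.

Cell `pub-namedobj`, target M, family B2 (cyclic / difference-set planes): the `n = 6` zero of the B2-cyclic control
row ('translation-class counts of cyclic planar difference sets for n = 2…11: 2, 4, 2, 10, 0, 12, 8, 12, 0, 36', two
engines) as a kernel theorem, by hand (Hall 1947): `no_planar_differenceSet_43`. Hall's multiplier theorem (Literature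
`DifferenceSetMultiplier`, Lander Thm 5.3) makes `3 ∣ n = 6` a multiplier; it fixes the translate with element-sum `0`
(Lander Thm 5.10); `3` is a primitive root modulo the prime `43` (`orderOf_three_zmod43`), so a non-zero element of
that translate has `42 > 7` distinct multiples `3^i x` inside it. (Order 6 has no plane at all — Bruck–Ryser / Tarry;
in the tree only conditionally on the Bruck–Ryser–Chowla named fact, `BruckRyserChowla.lean`; the cyclic case here is
unconditional.) Companions: `NoCyclicPlaneOrder10.lean` (`n = 10`), `PP12/NoOrder157.lean` (`n = 12`). Zero compute;
no `sorry`, no new axioms.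
-/

namespace Summit.Ventures.DiscreteObjects.MOLS

open Finset
open Literature.Combinatorics.Designs.DifferenceSets

/-- powers of `3` modulo `43`, evaluated in `ℕ` -/
theorem three_pow_zmod43_ne_one {e : ℕ} (h : 3 ^ e % 43 ≠ 1) : (3 : ZMod 43) ^ e ≠ 1 := by
  intro h1
  apply h
  have : ((3 ^ e : ℕ) : ZMod 43) = ((1 : ℕ) : ZMod 43) := by push_cast; exact h1
  rw [ZMod.natCast_eq_natCast_iff'] at this
  exact this

/-- `3` is a primitive root modulo `43`. -/
theorem orderOf_three_zmod43 : orderOf (3 : ZMod 43) = 42 := by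
  refine orderOf_eq_of_pow_and_pow_div_prime (by norm_num) ?_ ?_
  · have h : ((3 ^ 42 : ℕ) : ZMod 43) = ((1 : ℕ) : ZMod 43) := by
      rw [ZMod.natCast_eq_natCast_iff']; decide
    rw [Nat.cast_pow, Nat.cast_ofNat, Nat.cast_one] at h
    exact h
  · intro q hq hqd
    have h42 : (42 : ℕ) = 2 * (3 * 7) := by norm_num
    have hq' : q ∣ 2 * (3 * 7) := h42 ▸ hqd
    rcases (Nat.Prime.dvd_mul hq).mp hq' with h | h
    · have := (Nat.prime_dvd_prime_iff_eq hq Nat.prime_two).mp h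
      subst this
      exact three_pow_zmod43_ne_one (by decide)
    · rcases (Nat.Prime.dvd_mul hq).mp h with h | h
      · have := (Nat.prime_dvd_prime_iff_eq hq Nat.prime_three).mp h
        subst this
        exact three_pow_zmod43_ne_one (by decide)
      · have := (Nat.prime_dvd_prime_iff_eq hq (by norm_num : Nat.Prime 7)).mp h
        subst this
        exact three_pow_zmod43_ne_one (by decide)

/-- **No cyclic projective plane of order 6: there is no planar `(43, 7, 1)` difference set in `ℤ/43`** (kernel;
Hall 1947). -/
theorem no_planar_differenceSet_43 (D : Finset (ZMod 43)) (hD : IsDifferenceSet D 1) (hcard : D.card = 7) :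
    False := by
  classical
  haveI : Fact (Nat.Prime 43) := ⟨by norm_num⟩
  have hcardG : Fintype.card (ZMod 43) = 43 := ZMod.card 43
  -- sum-zero translate, fixed by the multiplier 3
  have hcop : (D.card).Coprime (Fintype.card (ZMod 43)) := by rw [hcard, hcardG]; norm_num
  obtain ⟨g, hg⟩ := IsDifferenceSet.exists_translate_sum_eq_zero D hcop
  set D' := D.image fun x => x + g with hD'def
  have hD' : IsDifferenceSet D' 1 := hD.image_add_right g
  have hcard' : D'.card = 7 := by rw [hD'def, Finset.card_image_of_injective _ (add_left_injective g), hcard]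
  have hcop' : (D'.card).Coprime (Fintype.card (ZMod 43)) := by rw [hcard', hcardG]; norm_num
  have h3ne : (3 : ZMod 43) ≠ 0 := by
    intro h
    have : ((3 : ℕ) : ZMod 43) = 0 := by exact_mod_cast h
    rw [ZMod.natCast_eq_zero_iff] at this
    omega
  have hinj : Function.Injective fun x : ZMod 43 => (3 : ℕ) • x := by
    intro a b hab
    simp only [nsmul_eq_mul, Nat.cast_ofNat] at hab
    exact mul_left_cancel₀ h3ne hab
  have h3 : D'.image (fun x => (3 : ℕ) • x) = D' := by
    obtain ⟨s, hs⟩ := hD'.multiplier Nat.prime_three (by norm_num) (by norm_num [hcard']) (by norm_num [hcard'])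
      (by norm_num [hcardG])
    exact IsDifferenceSet.image_nsmul_eq_self_of_sum_eq_zero D' hcop' hg hinj hs
  have hmul : ∀ x ∈ D', (3 : ZMod 43) * x ∈ D' := by
    intro x hx
    have : (3 : ℕ) • x ∈ D'.image (fun x => (3 : ℕ) • x) := mem_image_of_mem _ hx
    rw [h3] at this
    simpa [nsmul_eq_mul] using this
  have hpow : ∀ n : ℕ, ∀ x ∈ D', (3 : ZMod 43) ^ n * x ∈ D' := by
    intro n
    induction n with
    | zero => intro x hx; simpa using hx
    | succ n ih => intro x hx; rw [pow_succ', mul_assoc]; exact hmul _ (ih x hx)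
  -- a non-zero element of D'
  obtain ⟨x, hx, hx0⟩ : ∃ x ∈ D', x ≠ 0 := by
    obtain ⟨a, ha, b, hb, hab⟩ := Finset.one_lt_card.mp (by rw [hcard']; norm_num : 1 < D'.card)
    by_cases ha0 : a = 0
    · exact ⟨b, hb, fun hb0 => hab (ha0.trans hb0.symm)⟩
    · exact ⟨a, ha, ha0⟩
  -- its orbit under the primitive root 3 has 42 elements, all in D'
  have hsub : (Finset.range 42).image (fun n => (3 : ZMod 43) ^ n * x) ⊆ D' := by
    intro y hy
    obtain ⟨n, -, rfl⟩ := mem_image.mp hy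
    exact hpow n x hx
  have hinjOn : Set.InjOn (fun n => (3 : ZMod 43) ^ n * x) (Finset.range 42 : Set ℕ) := by
    intro a ha b hb hab
    have hab' : (3 : ZMod 43) ^ a = 3 ^ b := mul_right_cancel₀ hx0 hab
    have ha' : a ∈ Set.Iio (orderOf (3 : ZMod 43)) := by rw [orderOf_three_zmod43]; simpa using ha
    have hb' : b ∈ Set.Iio (orderOf (3 : ZMod 43)) := by rw [orderOf_three_zmod43]; simpa using hb
    exact pow_injOn_Iio_orderOf ha' hb' hab'
  have h42 : ((Finset.range 42).image fun n => (3 : ZMod 43) ^ n * x).card = 42 := by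
    rw [Finset.card_image_of_injOn hinjOn, Finset.card_range]
  have := Finset.card_le_card hsub
  rw [h42, hcard'] at this
  omega

end Summit.Ventures.DiscreteObjects.MOLS
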